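/-
Copyright: statement-level skeleton of a published paper (lit-balaban cell, Phase-2 proof seat p19, gen 4). No claims beyond
what the kernel checks below.
-/
import Mathlib
import Literature.MathematicalPhysics.QuantumFieldTheory.Balaban1983to89.B3AmpIBPClosed

/-!
# B3 — T. Bałaban, *(Higgs)₂,₃ quantum fields in a finite volume. III. Renormalization*, CMP **88** (1983) 411–445
[Balaban1983Higgs3] — Sect. 2, p. 426: the line bound (2.10) under the lattice operations of the integration by parts
(2.8)/(2.9) — shifted arguments `x − ηe_μ` cost a factor `e^{δ₁}`, *"for each differentiation, there is an additional factor
(L^jη)^{−1}"*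

statement-level skeleton of published theorems with citation tags; proofs where landed; nothing here is a claim about
the Yang–Mills mass gap

PDF held: `paper:balaban1983-higgs-2-3-quantum-fields-finite-volume` (journal page = PDF page + 410); displays (2.8)–(2.10)
and the sentences around them read on the ×2 renders `pub-balaban/b2b-balaban-ref1/pages/1983-cmp88-higgs23-III/
1983-cmp88-higgs23-III-p015, p016-x2.png` (pp. 425–426).

Part of the Phase-2 work on SKELETON rows **B3.Prop2.1 / B3.Prop2.2** (unit `lit-balaban-p19` gen 4, HOME
`run/shared/lean/pub/lit-balaban/`): the (2.4) EXCEPTION of Proposition 2.1, files `B3LatticeIBP` → `B3AmpIBP` →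
`B3AmpIBPClosed` → (`B3AmpIBPAll`, `B3IBPSites`, `B3IBPDegrees`, `B3IBPKernelBounds` = this file) → `B3AmpIBPBounds` →
`B3Prop21Except24`.

WHAT IS REPRODUCED.  p. 426 [PDF 16], verbatim: *"For the propagators G^η_{(j)} we apply the inequality |G^η_{(j)}(Ω, B̃; x,
x′)| ≦ O(1)(L^jη)^{−d+2}e^{−δ₁(L^jη)^{−1}|x−x′|}, (2.10) and if the propagator is differentiated, then for each differentiation,
there is an additional factor (L^jη)^{−1} on the right side. This applies also to Hölder norms"*, and p. 425: *"The effect of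
this transformation is that the graphs (2.4) are replaced by the graphs with degree +1."*  KERNEL-CHECKED HERE: the bound (2.10) in the
form `KBd` used by `B3Ineq213Amplitude.Amp.K_le` (`|F(t;x,y)| ≤ C (L^tη)^e exp[−δ₁(L^tη)^{−1}η|x−y|_∞]`) is stable under the
operations of `B3AmpIBP`/`B3AmpIBPClosed`: a shift of either or both arguments by `−e_μ` costs the factor `Esh = e^{δ₁}` in the
constant (`KBd.shX/shY/shXY`, from `η ≤ L^tη` and `|x−y|_∞ ≤ |x♭−y|_∞ + 1`); and given the DERIVATIVE BUDGET of a kernel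
(`KBudget`: (2.10) for the kernel and for its difference quotients in the first, the second, and both variables, exponent
lowered by one per differentiation — the printed *"additional factor (L^jη)^{−1}"*), the kernel of any term `G′∗` (operation
codes of the two variables, `B3AmpIBPClosed.apCode`) obeys (2.10) with the exponent lowered by the number of differentiations
and the constant `× (1 + e^{δ₁})²` (`KBudget.apCode_bound`, `KBudget.apCode_bound_loop`).
-/

open Finset

namespace Literature.MathematicalPhysics.QuantumFieldTheory.Balaban1983to89.B3Ineq213

open B3Ineq215

/-! ## Distances under the shift by `−e_μ` -/

section Dist

variable {d : ℕ}

/-- A truncated unit shift of one argument changes the sup-distance by at most one. [cite: Balaban1983Higgs3, (2.10) p.426] -/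
theorem supDist_le_bsh_left (μ : Fin d) (x y : Fin d → ℕ) : supDist x y ≤ supDist (bsh μ x) y + 1 := by
  unfold supDist
  refine Finset.sup_le fun i _ => ?_
  have hle : Nat.dist (bsh μ x i) (y i) ≤ univ.sup fun ν => Nat.dist (bsh μ x ν) (y ν) :=
    le_sup (f := fun ν => Nat.dist (bsh μ x ν) (y ν)) (mem_univ i)
  by_cases h : i = μ
  · subst h
    rw [bsh_apply_same] at hle
    unfold Nat.dist at hle ⊢
    omega
  · rw [bsh_apply_of_ne h] at hle
    omega

/-- A truncated unit shift of the other argument changes the sup-distance by at most one. [cite: Balaban1983Higgs3, (2.10) p.426] -/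
theorem supDist_le_bsh_right (μ : Fin d) (x y : Fin d → ℕ) : supDist x y ≤ supDist x (bsh μ y) + 1 := by
  rw [supDist_comm x y, supDist_comm x (bsh μ y)]
  exact supDist_le_bsh_left μ y x

/-- A truncated unit shift of both arguments changes the sup-distance by at most one. [cite: Balaban1983Higgs3, (2.10) p.426] -/
theorem supDist_le_bsh_both (μ : Fin d) (x y : Fin d → ℕ) : supDist x y ≤ supDist (bsh μ x) (bsh μ y) + 1 := by
  unfold supDist
  refine Finset.sup_le fun i _ => ?_
  have hle : Nat.dist (bsh μ x i) (bsh μ y i) ≤ univ.sup fun ν => Nat.dist (bsh μ x ν) (bsh μ y ν) :=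
    le_sup (f := fun ν => Nat.dist (bsh μ x ν) (bsh μ y ν)) (mem_univ i)
  by_cases h : i = μ
  · subst h
    rw [bsh_apply_same, bsh_apply_same] at hle
    unfold Nat.dist at hle ⊢
    omega
  · rw [bsh_apply_of_ne h, bsh_apply_of_ne h] at hle
    omega

end Dist

/-! ## Kernel bounds of the shape (2.10) and their behaviour under shift and difference -/

section KernelBounds

variable {V : Type} [Fintype V] [DecidableEq V] {m : ℕ} (M : Model V m) (k : ℕ)

/-- The bound (2.10) in the form used by `Amp.K_le`: `|F(t; x, y)| ≤ C (L^tη)^e exp[−2δ₀(L^tη)^{−1} η|x−y|_∞]` for `t < k`.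
[cite: Balaban1983Higgs3, (2.10) p.426] -/
def KBd (C e : ℝ) (F : Ker M.d) : Prop :=
  ∀ t, t < k → ∀ x y, |F t x y| ≤ C * M.sc k t ^ e
    * Real.exp (-(2 * M.δ₀ / M.sc k t * (((M.L : ℝ) ^ k)⁻¹ * (supDist x y : ℝ))))

/-- The factor produced by one shifted argument: `e^{2δ₀} = e^{δ₁}`. [cite: Balaban1983Higgs3, (2.10) p.426] -/
noncomputable def Esh : ℝ := Real.exp (2 * M.δ₀)

/-- `Esh ≥ 1`. [cite: Balaban1983Higgs3, (2.10) p.426] -/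
theorem one_le_Esh : 1 ≤ Esh M := Real.one_le_exp (by have := M.δ₀_pos; positivity)

variable {M k}

/-- The exponential of (2.10) loses at most the factor `e^{2δ₀}` when the distance drops by one (`η ≤ L^tη`).
[cite: Balaban1983Higgs3, (2.10) p.426] -/
theorem exp_shift_le {t : ℕ} {D D' : ℕ} (hD : D ≤ D' + 1) :
    Real.exp (-(2 * M.δ₀ / M.sc k t * (((M.L : ℝ) ^ k)⁻¹ * (D' : ℝ))))
      ≤ Esh M * Real.exp (-(2 * M.δ₀ / M.sc k t * (((M.L : ℝ) ^ k)⁻¹ * (D : ℝ)))) := by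
  unfold Esh
  rw [← Real.exp_add]
  apply Real.exp_le_exp.2
  have hsc : 0 < M.sc k t := M.sc_pos k t
  have hη : 0 < ((M.L : ℝ) ^ k)⁻¹ := by have := M.L_pos_real; positivity
  have hδ : 0 < M.δ₀ := M.δ₀_pos
  have hc : 0 ≤ 2 * M.δ₀ / M.sc k t * ((M.L : ℝ) ^ k)⁻¹ := by positivity
  -- `η / (L^tη) ≤ 1`
  have hηsc : ((M.L : ℝ) ^ k)⁻¹ ≤ M.sc k t := by
    unfold Model.sc
    exact le_mul_of_one_le_left hη.le (one_le_pow₀ M.one_lt_L.le)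
  have hc1 : 2 * M.δ₀ / M.sc k t * ((M.L : ℝ) ^ k)⁻¹ ≤ 2 * M.δ₀ := by
    rw [div_mul_eq_mul_div, div_le_iff₀ hsc]
    exact mul_le_mul_of_nonneg_left hηsc (by positivity)
  have hD' : (D : ℝ) ≤ (D' : ℝ) + 1 := by exact_mod_cast hD
  set c := 2 * M.δ₀ / M.sc k t * ((M.L : ℝ) ^ k)⁻¹ with hcdef
  have h1 : c * (D : ℝ) ≤ c * (D' : ℝ) + 2 * M.δ₀ := by
    calc c * (D : ℝ) ≤ c * ((D' : ℝ) + 1) := mul_le_mul_of_nonneg_left hD' hc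
      _ = c * (D' : ℝ) + c := by ring
      _ ≤ _ := by linarith
  have e1 : 2 * M.δ₀ / M.sc k t * (((M.L : ℝ) ^ k)⁻¹ * (D' : ℝ)) = c * (D' : ℝ) := by rw [hcdef]; ring
  have e2 : 2 * M.δ₀ / M.sc k t * (((M.L : ℝ) ^ k)⁻¹ * (D : ℝ)) = c * (D : ℝ) := by rw [hcdef]; ring
  rw [e1, e2]
  linarith

/-- A bound with a larger constant. [cite: Balaban1983Higgs3, (2.10) p.426] -/
theorem KBd.mono {C C' e : ℝ} {F : Ker M.d} (h : KBd M k C e F) (hC : C ≤ C') : KBd M k C' e F := by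
  intro t ht x y
  refine (h t ht x y).trans ?_
  exact mul_le_mul_of_nonneg_right (mul_le_mul_of_nonneg_right hC (Real.rpow_nonneg (M.sc_pos k t).le _))
    (Real.exp_pos _).le

/-- Rewriting the exponent of a bound. [cite: Balaban1983Higgs3, (2.10) p.426] -/
theorem KBd.of_eq {C e e' : ℝ} {F : Ker M.d} (h : KBd M k C e F) (he : e = e') : KBd M k C e' F := he ▸ h

/-- Unfolding of the shift in the first variable. [cite: Balaban1983Higgs3, (2.8) p.425] -/
theorem shK_tf_apply (μ : Fin M.d) (F : Ker M.d) (t : ℕ) (x y : Fin M.d → ℕ) :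
    shK μ true false F t x y = F t (bsh μ x) y := by simp [shK]

/-- Unfolding of the shift in the second variable. [cite: Balaban1983Higgs3, (2.8) p.425] -/
theorem shK_ft_apply (ν : Fin M.d) (F : Ker M.d) (t : ℕ) (x y : Fin M.d → ℕ) :
    shK ν false true F t x y = F t x (bsh ν y) := by simp [shK]

/-- Unfolding of the shift in both variables. [cite: Balaban1983Higgs3, (2.8) p.425] -/
theorem shK_tt_apply (μ : Fin M.d) (F : Ker M.d) (t : ℕ) (x y : Fin M.d → ℕ) :
    shK μ true true F t x y = F t (bsh μ x) (bsh μ y) := by simp [shK]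

/-- **Shift in the first variable**: the bound survives with the factor `e^{2δ₀}`. [cite: Balaban1983Higgs3, (2.10) p.426] -/
theorem KBd.shX {C e : ℝ} {F : Ker M.d} (h : KBd M k C e F) (hC : 0 ≤ C) (μ : Fin M.d) :
    KBd M k (C * Esh M) e (shK μ true false F) := by
  intro t ht x y
  rw [shK_tf_apply]
  refine (h t ht (bsh μ x) y).trans ?_
  have hmain := exp_shift_le (M := M) (k := k) (t := t) (supDist_le_bsh_left μ x y)
  have hCs : 0 ≤ C * M.sc k t ^ e := mul_nonneg hC (Real.rpow_nonneg (M.sc_pos k t).le _)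
  calc C * M.sc k t ^ e * Real.exp (-(2 * M.δ₀ / M.sc k t * (((M.L : ℝ) ^ k)⁻¹ * (supDist (bsh μ x) y : ℝ))))
      ≤ C * M.sc k t ^ e * (Esh M * Real.exp (-(2 * M.δ₀ / M.sc k t * (((M.L : ℝ) ^ k)⁻¹ * (supDist x y : ℝ))))) :=
        mul_le_mul_of_nonneg_left hmain hCs
    _ = _ := by ring

/-- **Shift in the second variable**. [cite: Balaban1983Higgs3, (2.10) p.426] -/
theorem KBd.shY {C e : ℝ} {F : Ker M.d} (h : KBd M k C e F) (hC : 0 ≤ C) (ν : Fin M.d) :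
    KBd M k (C * Esh M) e (shK ν false true F) := by
  intro t ht x y
  rw [shK_ft_apply]
  refine (h t ht x (bsh ν y)).trans ?_
  have hmain := exp_shift_le (M := M) (k := k) (t := t) (supDist_le_bsh_right ν x y)
  have hCs : 0 ≤ C * M.sc k t ^ e := mul_nonneg hC (Real.rpow_nonneg (M.sc_pos k t).le _)
  calc C * M.sc k t ^ e * Real.exp (-(2 * M.δ₀ / M.sc k t * (((M.L : ℝ) ^ k)⁻¹ * (supDist x (bsh ν y) : ℝ))))
      ≤ C * M.sc k t ^ e * (Esh M * Real.exp (-(2 * M.δ₀ / M.sc k t * (((M.L : ℝ) ^ k)⁻¹ * (supDist x y : ℝ))))) :=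
        mul_le_mul_of_nonneg_left hmain hCs
    _ = _ := by ring

/-- **Shift in both variables** (a loop at the site vertex). [cite: Balaban1983Higgs3, (2.10) p.426] -/
theorem KBd.shXY {C e : ℝ} {F : Ker M.d} (h : KBd M k C e F) (hC : 0 ≤ C) (μ : Fin M.d) :
    KBd M k (C * Esh M) e (shK μ true true F) := by
  intro t ht x y
  rw [shK_tt_apply]
  refine (h t ht (bsh μ x) (bsh μ y)).trans ?_
  have hmain := exp_shift_le (M := M) (k := k) (t := t) (supDist_le_bsh_both μ x y)
  have hCs : 0 ≤ C * M.sc k t ^ e := mul_nonneg hC (Real.rpow_nonneg (M.sc_pos k t).le _)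
  calc C * M.sc k t ^ e * Real.exp (-(2 * M.δ₀ / M.sc k t * (((M.L : ℝ) ^ k)⁻¹ * (supDist (bsh μ x) (bsh μ y) : ℝ))))
      ≤ C * M.sc k t ^ e * (Esh M * Real.exp (-(2 * M.δ₀ / M.sc k t * (((M.L : ℝ) ^ k)⁻¹ * (supDist x y : ℝ))))) :=
        mul_le_mul_of_nonneg_left hmain hCs
    _ = _ := by ring

/-- The sum of two bounded kernels. [cite: Balaban1983Higgs3, (2.10) p.426] -/
theorem KBd.add {C C' e : ℝ} {F F' : Ker M.d} (h : KBd M k C e F) (h' : KBd M k C' e F') :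
    KBd M k (C + C') e (fun t x y => F t x y + F' t x y) := by
  intro t ht x y
  have := h t ht x y
  have := h' t ht x y
  calc |F t x y + F' t x y| ≤ |F t x y| + |F' t x y| := abs_add_le _ _
    _ ≤ _ := by linarith

/-- **The derivative budget of a kernel**: (2.10) for the kernel, for its difference quotients in the first variable, in the
second variable, and in both, in every direction, with the exponent lowered by one per differentiation — *"for each
differentiation, there is an additional factor (L^jη)^{−1}"*. [cite: Balaban1983Higgs3, (2.10) p.426] -/
structure KBudget (M : Model V m) (k : ℕ) (C e : ℝ) (F : Ker M.d) : Prop where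
  le0 : KBd M k C e F
  leX : ∀ μ, KBd M k C (e - 1) (dK ((M.L : ℝ) ^ k) μ true false F)
  leY : ∀ ν, KBd M k C (e - 1) (dK ((M.L : ℝ) ^ k) ν false true F)
  leXY : ∀ μ ν, KBd M k C (e - 2) (dK ((M.L : ℝ) ^ k) μ true false (dK ((M.L : ℝ) ^ k) ν false true F))

/-- Difference in the first variable and shift in the second commute. [cite: Balaban1983Higgs3, (2.8) p.425] -/
theorem dK_tf_shK_ft (s : ℝ) (μ ν : Fin M.d) (F : Ker M.d) :
    dK s μ true false (shK ν false true F) = shK ν false true (dK s μ true false F) := by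
  funext t x y; simp [dK, shK]

/-- Shift in the first variable and difference in the second commute. [cite: Balaban1983Higgs3, (2.8) p.425] -/
theorem shK_tf_dK_ft (s : ℝ) (μ ν : Fin M.d) (F : Ker M.d) :
    shK μ true false (dK s ν false true F) = dK s ν false true (shK μ true false F) := by
  funext t x y; simp [dK, shK]

/-- Shifts in the two variables commute. [cite: Balaban1983Higgs3, (2.8) p.425] -/
theorem shK_tf_shK_ft (μ ν : Fin M.d) (F : Ker M.d) :
    shK μ true false (shK ν false true F) = shK ν false true (shK μ true false F) := by
  funext t x y; simp [shK]

/-- The joint difference of a loop kernel splits into a first-variable difference and a shifted second-variable difference: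
`s(K(x,y) − K(x♭,y♭)) = (∂⁻_x K)(x,y) + (∂⁻_y K)(x♭,y)`. [cite: Balaban1983Higgs3, (2.8) p.425] -/
theorem dK_tt_eq (s : ℝ) (μ : Fin M.d) (F : Ker M.d) :
    dK s μ true true F = fun t x y => dK s μ true false F t x y + shK μ true false (dK s μ false true F) t x y := by
  funext t x y; simp [dK, shK]; ring

/-- The number of differentiations performed by a code (`1` for the code `2`, else `0`). [cite: Balaban1983Higgs3, (2.9) p.425] -/
def nd (n : ℕ) : ℕ := if n = 2 then 1 else 0

/-- **The kernels of `G′∗`: the operations of the two variables cost one `(L^jη)^{−1}` per differentiation and at most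
`(1 + e^{2δ₀})²` in the constant.** [cite: Balaban1983Higgs3, (2.10) p.426] -/
theorem KBudget.apCode_bound {C e : ℝ} {F : Ker M.d} (h : KBudget M k C e F) (hC : 0 ≤ C) {nx ny : ℕ} (hx : nx ≤ 2)
    (hy : ny ≤ 2) (μ ν : Fin M.d) :
    KBd M k (C * (1 + Esh M) ^ 2) (e - ((nd nx + nd ny : ℕ) : ℝ))
      (apCode nx ((M.L : ℝ) ^ k) μ true false (apCode ny ((M.L : ℝ) ^ k) ν false true F)) := by
  have hE := one_le_Esh M
  have hE0 : 0 ≤ Esh M := le_trans zero_le_one hE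
  have hsq : (1 + Esh M) ^ 2 = 1 + Esh M + Esh M + Esh M * Esh M := by ring
  have hCE : C * Esh M ≤ C * (1 + Esh M) ^ 2 := mul_le_mul_of_nonneg_left (by rw [hsq]; nlinarith) hC
  have hCEE : C * Esh M * Esh M ≤ C * (1 + Esh M) ^ 2 := by
    rw [mul_assoc]; exact mul_le_mul_of_nonneg_left (by rw [hsq]; nlinarith) hC
  have hC1 : C ≤ C * (1 + Esh M) ^ 2 := le_mul_of_one_le_right hC (one_le_pow₀ (by linarith))
  interval_cases nx <;> interval_cases ny
  · simp only [apCode_zero]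
    exact (h.le0.mono hC1).of_eq (by norm_num [nd])
  · simp only [apCode_zero, apCode_one]
    exact ((h.le0.shY hC ν).mono hCE).of_eq (by norm_num [nd])
  · simp only [apCode_zero, apCode_two]
    exact ((h.leY ν).mono hC1).of_eq (by norm_num [nd])
  · simp only [apCode_zero, apCode_one]
    exact ((h.le0.shX hC μ).mono hCE).of_eq (by norm_num [nd])
  · simp only [apCode_one]
    rw [shK_tf_shK_ft]
    exact (((h.le0.shX hC μ).shY (mul_nonneg hC hE0) ν).mono hCEE).of_eq (by norm_num [nd])
  · simp only [apCode_one, apCode_two]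
    exact (((h.leY ν).shX hC μ).mono hCE).of_eq (by norm_num [nd])
  · simp only [apCode_zero, apCode_two]
    exact ((h.leX μ).mono hC1).of_eq (by norm_num [nd])
  · simp only [apCode_one, apCode_two]
    rw [dK_tf_shK_ft]
    exact (((h.leX μ).shY hC ν).mono hCE).of_eq (by norm_num [nd])
  · simp only [apCode_two]
    exact ((h.leXY μ ν).mono hC1).of_eq (by norm_num [nd])

/-- **The kernel of a loop at a site vertex** (both variables operated on jointly). [cite: Balaban1983Higgs3, (2.10) p.426] -/
theorem KBudget.apCode_bound_loop {C e : ℝ} {F : Ker M.d} (h : KBudget M k C e F) (hC : 0 ≤ C) {nx : ℕ} (hx : nx ≤ 2)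
    (μ : Fin M.d) :
    KBd M k (C * (1 + Esh M) ^ 2) (e - ((nd nx : ℕ) : ℝ)) (apCode nx ((M.L : ℝ) ^ k) μ true true F) := by
  have hE := one_le_Esh M
  have hE0 : 0 ≤ Esh M := le_trans zero_le_one hE
  have hsq : (1 + Esh M) ^ 2 = 1 + Esh M + Esh M + Esh M * Esh M := by ring
  have hCE : C * Esh M ≤ C * (1 + Esh M) ^ 2 := mul_le_mul_of_nonneg_left (by rw [hsq]; nlinarith) hC
  have hC1 : C ≤ C * (1 + Esh M) ^ 2 := le_mul_of_one_le_right hC (one_le_pow₀ (by linarith))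
  have hC1E : C + C * Esh M ≤ C * (1 + Esh M) ^ 2 := by
    rw [show C + C * Esh M = C * (1 + Esh M) by ring]
    exact mul_le_mul_of_nonneg_left (by rw [hsq]; nlinarith) hC
  interval_cases nx
  · simp only [apCode_zero]
    exact (h.le0.mono hC1).of_eq (by norm_num [nd])
  · simp only [apCode_one]
    exact ((h.le0.shXY hC μ).mono hCE).of_eq (by norm_num [nd])
  · simp only [apCode_two]
    rw [dK_tt_eq]
    exact (((h.leX μ).add ((h.leY μ).shX hC μ)).mono hC1E).of_eq (by norm_num [nd])

end KernelBounds

end Literature.MathematicalPhysics.QuantumFieldTheory.Balaban1983to89.B3Ineq213
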